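import Literature.MathematicalPhysics.QuantumFieldTheory.Balaban1983to89.B5Lagrange149Torus

/-!
# `Balaban1983to89.B5Phi176Torus` — T. Bałaban, *Propagators and renormalization transformations for
# lattice gauge theories. I*, Commun. Math. Phys. **95** (1984) 17–40 [Balaban1984PropagatorsI]:
# the Sect. E operator `φ = I + aQΔ⁻¹Q*` of (1.76) with its symbol (1.84), `φ⁻¹`, `∂₁*φ⁻¹∂₁` and
# `(∂₁*φ⁻¹∂₁)⁻¹` on the torus, and the mechanism «RΔ⁻¹Q′* = 0» of p. 33 — support module of
# `B5Eq194DivG` ((1.94)/(1.96))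

statement-level skeleton of published theorems with citation tags; proofs where landed; nothing here is a claim about the Yang–Mills mass gap

PDF held: `paper:balaban1984-cmp95-propagators-rt-i` (journal page = PDF page + 16); pp. 30–33 read this
session from the page renders `1984-cmp95-propagators-rt-I-p014-x4.png`, `-p015-x4.png`, `-p016-x4.png`,
`-p017-x4.png` (not from OCR).

WHAT IS REPRODUCED.  Support of SKELETON rows **B5.Eq1.95** (member (1.94)) and **B5.Eq1.97** (member (1.96))
of `run/shared/lean/pub/lit-balaban/SKELETON.md` (the objects of (1.76)/(1.84) that (1.94)/(1.96) are written
in; row B5.Eq1.81 lists (1.76) as proved fibrewise in `B5Prop11Inverse` — here it is typed IN POSITION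
SPACE on the torus, as `B5Phi162Torus` did for the Sect. D `φ` of (1.58)).  Phase-2 seat **p37** (gen 3) of
`PHASE2-TARGETS.md` §G (cell `lit-balaban`, unit `lit-balaban-p37`, HOME `run/shared/lean/pub/lit-balaban/`).

## The printed text (p. 30, p. 31, p. 33; verbatim)

p. 30: «Let us denote  φ = I + aQΔ⁻¹Q*.   (1.76)
It is a well-defined and positive operator on the subspace of vector functions defined on the unit lattice
T₁^{(k)} and orthogonal to constant functions. Applying φ⁻¹ to (1.75) we get …»
p. 31: «We know that the operator Q′Δ⁻²Q′* is positive on the considered subspace. It is easy to see that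
∂₁*φ⁻¹∂₁ is positive also because φ⁻¹ is positive»; (1.84): «φ_μ(p′) = 1 + aΣ_{l″}|u(p′+l″)|²|v_μ(p′+l″)|²
/Δ(p′+l″) for p′ ≠ 0.»; (1.82): «GJ = GJ′ + a⁻¹J₀.»
p. 33: «The operator ∂*GQ* acting on a constant configuration gives 0 …  The operator R is given by the
formula R = I − P = I − Δ⁻¹Q′*·(Q′Δ⁻²Q′*)⁻¹Q′Δ⁻¹, so RΔ⁻¹Q′* = 0».

## Dictionary and what is certified (kernel, zero `sorry`, standard axioms)

Typed torus operators as in `B5Hk160Torus`/`B5Phi162Torus` (`T_η = Tor (fine n M)`, unit lattice `Tor M`,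
`n = L^k`, any `d`, `n ≥ 1`, `M_μ ≥ 1`): `∂₁ = GradOp M 1`, scalar `Δ⁻¹ = LapSinv`, componentwise
`Δ⁻¹ = LapVinv`, `Q = QvOp`, `Q* = QvAdj`, `Q′ = QsOp`, `Q′* = QsAdj`, `(Q′Δ⁻²Q′*)⁻¹ = Einv` (on `1^⊥`),
`P = PcT` ((1.70)), `Δ_a = DeltaA`, `G = (DeltaA)⁻¹` ((1.71)).  NEW (defs with bodies): **`Phi176 a
:= 1 + a•PhiOp`** ((1.76); `PhiOp = QΔ⁻¹Q*` is the Sect. D `φ` of (1.58), a different operator also printed «φ»),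
its symbol **`phi184`** ((1.84), `= 1 + a·phi162`), **`Phi176Inv`** (the coarse Fourier multiplier `φ_μ(p′)⁻¹`),
**`GPhiE := ∂₁*φ⁻¹∂₁`** with symbol **`gsymE`**, **`GPhiEInv := (∂₁*φ⁻¹∂₁)⁻¹`** (scalar multiplier on `1^⊥`).
Certified: §1 `dft_Phi176` ((1.76) IS the multiplier (1.84)), `φ_μ ≥ 1 > 0` for `a ≥ 0` (`phi184_pos`) hence
`φφ⁻¹ = φ⁻¹φ = I` on ALL of `L²(T₁^{(k)}; ℂ^d)` (`Phi176_mul_Phi176Inv`, `Phi176Inv_mul_Phi176`), `φ`, `φ⁻¹` fix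
constants, `I − aφ⁻¹QΔ⁻¹Q* = φ⁻¹` (`Phi176Inv_eq_sub`); the symbol of `∂₁*φ⁻¹∂₁` is non-zero off `p′ = 0`
(«∂₁*φ⁻¹∂₁ is positive», `gsymE_ne_zero`) and `GPhiEInv` inverts it on `1^⊥` (`GPhiE_GPhiEInv_of_orth`,
`GPhiEInv_GPhiE_of_orth`).  §2: `Δ⁻¹Δ = I` on vector fields `⊥` constants, `Δ⁻¹∂ = ∂Δ⁻¹`, (1.73) expanded
(`DeltaA_mulVec'`), **(1.74)** (`orthConst_of_DeltaA_eq`: `J ⊥ 1 ⇒ A ⊥ 1`), `Δ_aA₀ = aA₀` and **(1.82)** `GA₀ =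
a⁻¹A₀` on constants (`G_constV`), «∂*GQ* acting on a constant configuration gives 0» (`divS_G_QvAdj_constV`),
and **«RΔ⁻¹Q′* = 0»**:
`PΔ⁻¹Q′* = Δ⁻¹Q′*` on every unit-lattice scalar (`PcT_LapSinv_QsAdj`), `(I − P)Δ⁻¹Q′* = 0`
(`oneSubPcT_LapSinv_QsAdj`).

HONEST SCOPE.  Finite torus, complex fields, unitary DFT, `Δ⁻¹ := 0` on constants (p. 22) as everywhere in the
B5 tree modules; (1.76)/(1.84) typed and their elementary operator facts proved — nothing of Prop. 1.1/1.2.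
NOT summit progress.
-/

open scoped BigOperators Matrix ComplexConjugate
open Finset Complex

namespace Literature.MathematicalPhysics.QuantumFieldTheory.Balaban1983to89.B5Phi176Torus

open Literature.MathematicalPhysics.QuantumFieldTheory.Balaban1983to89
open Literature.MathematicalPhysics.QuantumFieldTheory.Balaban1983to89.B5Prop11Plancherel (Tor dft fine sOf
  sOf_zero)
open Literature.MathematicalPhysics.QuantumFieldTheory.Balaban1983to89.B5Prop11Lower (Lap)
open Literature.MathematicalPhysics.QuantumFieldTheory.Balaban1983to89.B5Action121 (comp sdiff LapS GradOp
  divS GradOp_conjTranspose_mul_GradOp GradOp_conjTranspose_mulVec_eq GradOp_mulVec)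
open Literature.MathematicalPhysics.QuantumFieldTheory.Balaban1983to89.B5Block118 (QsOp QvOp cT)
open Literature.MathematicalPhysics.QuantumFieldTheory.Balaban1983to89.B5LaplaceInverse (ssym lsym LapSinv
  Pker LapS_mul_LapSinv LapSinv_mul_LapS LapSinv_mul_Pker Pker_mul_LapSinv LapS_mul_Pker Pker_mul_Pker
  Pker_conjTranspose LapSinv_conjTranspose Pker_orth LapS_LapSinv_of_orth LapSinv_LapS_of_orth
  LapSinv_const sum_LapSinv)
open Literature.MathematicalPhysics.QuantumFieldTheory.Balaban1983to89.B5Momentum130 (dft_zero_apply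
  lsym_zero lsym_eq_zero_iff dft_LapS_apply)
open Literature.MathematicalPhysics.QuantumFieldTheory.Balaban1983to89.B5Momentum133 (dft_LapSinv_apply)
open Literature.MathematicalPhysics.QuantumFieldTheory.Balaban1983to89.B5DeltaA169 (QvAdj QvAdj_mulVec
  DeltaA isUnit_DeltaA dft_comp_GradOp dft_GradOp_adjoint)
open Literature.MathematicalPhysics.QuantumFieldTheory.Balaban1983to89.B5Substitution125 (Mop Minv
  Mop_mulVec Mop_Minv_of_orth Minv_Mop_of_orth QsOp_adjoint_orth QsOp_adjoint_const QsOp_orth)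
open Literature.MathematicalPhysics.QuantumFieldTheory.Balaban1983to89.B5Value126 (PcT PcT_mulVec
  PcT_conjTranspose sum_QsOp_LapSinv sum_Minv_of_orth)
open Literature.MathematicalPhysics.QuantumFieldTheory.Balaban1983to89.B5DivOrth (sum_GradOp_adjoint
  sum_LapS)
open Literature.MathematicalPhysics.QuantumFieldTheory.Balaban1983to89.B5Hk163Torus (dft_mulVec_injective)
open Literature.MathematicalPhysics.QuantumFieldTheory.Balaban1983to89.B5Bounds167Lattice (phi162
  phi162_nonneg)
open Literature.MathematicalPhysics.QuantumFieldTheory.Balaban1983to89.B5Phi162Torus (comp_smul eq_of_comp_eq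
  OrthConst dft_comp_zero_of_orthConst orthConst_of_dft_comp_zero dft_const_of_ne cMul dft_cMul LapVinv
  comp_LapVinv_mulVec PhiOp PhiOp_mulVec dft_PhiOp PhiOp_mulVec_const orthConst_PhiOp_mulVec)
open Literature.MathematicalPhysics.QuantumFieldTheory.Balaban1983to89.B5Hk160Torus (sum_eq_zero_iff_dft_zero
  sMul dft_sMul ssym_zero divS_GradOp_mulVec orthConst_GradOp constV divS_constV orthConst_sub dft_comp_Lap
  Lap_LapVinv_of_orthConst divS_LapVinv Lap_GradOp_mulVec QvAdj_constV QvOp_constV Lap_constV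
  orthConst_QvAdj B0 Bp orthConst_Bp Bp_add_B0 QvOp_GradOp_mulVec QsAdj divS_QvAdj Einv QsAdj_Einv
  QsOp_LapSinv2_QsAdj_Einv)

noncomputable section

variable {d : ℕ} (n : ℕ) [NeZero n] (M : Fin d → ℕ) [hM : ∀ μ, NeZero (M μ)] (a : ℝ)

/-! ## §0 Small tools -/

omit [NeZero n] hM in
/-- two (rectangular) matrices agree if they agree on every vector. [folklore] -/
private theorem ext_mulVec {m k : Type*} [Fintype k] [DecidableEq k] {A B : Matrix m k ℂ}
    (h : ∀ v, A *ᵥ v = B *ᵥ v) : A = B :=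
  Matrix.toLin'.injective (LinearMap.ext fun v => by rw [Matrix.toLin'_apply, Matrix.toLin'_apply, h v])

omit [NeZero n] hM in
/-- components are additive: `(X + Y)_κ = X_κ + Y_κ`. [folklore] -/
private theorem comp_add {N : Fin d → ℕ} (X Y : Tor N × Fin d → ℂ) (κ : Fin d) :
    comp N (X + Y) κ = comp N X κ + comp N Y κ := rfl

omit [NeZero n] hM in
/-- components of a difference: `(X − Y)_κ = X_κ − Y_κ`. [folklore] -/
private theorem comp_sub {N : Fin d → ℕ} (X Y : Tor N × Fin d → ℂ) (κ : Fin d) :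
    comp N (X - Y) κ = comp N X κ - comp N Y κ := rfl

/-! ## §1 (1.76): `φ = I + aQΔ⁻¹Q*`, its symbol (1.84), `φ⁻¹`, and `(∂₁*φ⁻¹∂₁)⁻¹` -/

/-- **(1.76) TYPED**: «φ = I + aQΔ⁻¹Q*» — the Sect. E operator on vector functions on the unit lattice
(`QΔ⁻¹Q* = B5Phi162Torus.PhiOp`, the Sect. D `φ` of (1.58), is a different operator).
[cite: Balaban1984PropagatorsI, (1.76) p.30] -/
def Phi176 : Matrix (Tor M × Fin d) (Tor M × Fin d) ℂ := 1 + (a : ℂ) • PhiOp n M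

/-- **(1.84) TYPED**: «φ_μ(p′) = 1 + aΣ_{l″}|u(p′+l″)|²|v_μ(p′+l″)|²/Δ(p′+l″)» — the symbol of (1.76)
(`= 1 + a·φ_μ^{(1.62)}(p′)`, `B5Bounds167Lattice.phi162`), at `p′ = sOf q`.
[cite: Balaban1984PropagatorsI, (1.84) p.31] -/
def phi184 (μ : Fin d) (q : Tor M) : ℝ := 1 + a * phi162 n μ (sOf M q)

/-- `φB = B + a·QΔ⁻¹Q*B`. [cite: Balaban1984PropagatorsI, (1.76) p.30] -/
theorem Phi176_mulVec (B : Tor M × Fin d → ℂ) :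
    Phi176 n M a *ᵥ B = B + (a : ℂ) • (PhiOp n M *ᵥ B) := by
  rw [Phi176, Matrix.add_mulVec, Matrix.one_mulVec, Matrix.smul_mulVec]

/-- **(1.76) is the multiplier (1.84)**: `(φB)~_μ(p′) = φ_μ(p′)B̃_μ(p′)` (via (1.62) `dft_PhiOp`).
[cite: Balaban1984PropagatorsI, (1.76) p.30, (1.84) p.31] -/
theorem dft_Phi176 (B : Tor M × Fin d → ℂ) (q : Tor M) (μ : Fin d) :
    (dft M *ᵥ comp M (Phi176 n M a *ᵥ B) μ) q
      = ((phi184 n M a μ q : ℝ) : ℂ) * (dft M *ᵥ comp M B μ) q := by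
  rw [Phi176_mulVec, comp_add, comp_smul, Matrix.mulVec_add, Matrix.mulVec_smul, Pi.add_apply,
    Pi.smul_apply, smul_eq_mul, dft_PhiOp, phi184]
  push_cast
  ring

omit [NeZero n] hM in
/-- «It is a well-defined and positive operator»: `φ_μ(p′) = 1 + a·(…) ≥ 1 > 0` for `a ≥ 0` (on ALL `p′`,
including `p′ = 0`). [cite: Balaban1984PropagatorsI, p.30 after (1.76)] -/
theorem phi184_pos (ha : 0 ≤ a) (μ : Fin d) (q : Tor M) : 0 < phi184 n M a μ q :=
  add_pos_of_pos_of_nonneg one_pos (mul_nonneg ha (phi162_nonneg n μ _))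

omit [NeZero n] hM in
/-- `φ_μ(p′) ≠ 0` as a complex number (`a ≥ 0`; «positive operator»). [cite: Balaban1984PropagatorsI, p.30 after (1.76)] -/
theorem phi184_ne_zero (ha : 0 ≤ a) (μ : Fin d) (q : Tor M) : ((phi184 n M a μ q : ℝ) : ℂ) ≠ 0 := by
  exact_mod_cast (phi184_pos n M a ha μ q).ne'

/-- **`φ⁻¹`** («Applying φ⁻¹ to (1.75)»): the coarse componentwise Fourier multiplier `φ_μ(p′)⁻¹`.
[cite: Balaban1984PropagatorsI, (1.77) p.30, (1.84) p.31] -/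
def Phi176Inv : Matrix (Tor M × Fin d) (Tor M × Fin d) ℂ :=
  cMul M fun μ q => (((phi184 n M a μ q : ℝ) : ℂ))⁻¹

omit [NeZero n] in
/-- `(φ⁻¹B)~_μ(p′) = φ_μ(p′)⁻¹B̃_μ(p′)`. [cite: Balaban1984PropagatorsI, (1.84) p.31] -/
theorem dft_Phi176Inv (B : Tor M × Fin d → ℂ) (q : Tor M) (μ : Fin d) :
    (dft M *ᵥ comp M (Phi176Inv n M a *ᵥ B) μ) q
      = (((phi184 n M a μ q : ℝ) : ℂ))⁻¹ * (dft M *ᵥ comp M B μ) q :=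
  dft_cMul M _ B μ q

/-- **`φφ⁻¹ = I`** on every vector function (`a ≥ 0`). [cite: Balaban1984PropagatorsI, p.30 after (1.76)] -/
theorem Phi176_Phi176Inv_mulVec (ha : 0 ≤ a) (B : Tor M × Fin d → ℂ) :
    Phi176 n M a *ᵥ (Phi176Inv n M a *ᵥ B) = B := by
  refine eq_of_comp_eq M fun μ => dft_mulVec_injective M ?_
  funext q
  show (dft M *ᵥ comp M (Phi176 n M a *ᵥ (Phi176Inv n M a *ᵥ B)) μ) q = (dft M *ᵥ comp M B μ) q
  rw [dft_Phi176, dft_Phi176Inv, ← mul_assoc, mul_inv_cancel₀ (phi184_ne_zero n M a ha μ q), one_mul]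

/-- **`φ⁻¹φ = I`** on every vector function (`a ≥ 0`). [cite: Balaban1984PropagatorsI, p.30 after (1.76)] -/
theorem Phi176Inv_Phi176_mulVec (ha : 0 ≤ a) (B : Tor M × Fin d → ℂ) :
    Phi176Inv n M a *ᵥ (Phi176 n M a *ᵥ B) = B := by
  refine eq_of_comp_eq M fun μ => dft_mulVec_injective M ?_
  funext q
  show (dft M *ᵥ comp M (Phi176Inv n M a *ᵥ (Phi176 n M a *ᵥ B)) μ) q = (dft M *ᵥ comp M B μ) q
  rw [dft_Phi176Inv, dft_Phi176, ← mul_assoc, inv_mul_cancel₀ (phi184_ne_zero n M a ha μ q), one_mul]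

/-- `φ·φ⁻¹ = 1` as matrices. [cite: Balaban1984PropagatorsI, p.30 after (1.76)] -/
theorem Phi176_mul_Phi176Inv (ha : 0 ≤ a) : Phi176 n M a * Phi176Inv n M a = 1 :=
  ext_mulVec fun B => by rw [← Matrix.mulVec_mulVec, Phi176_Phi176Inv_mulVec n M a ha, Matrix.one_mulVec]

/-- `φ⁻¹·φ = 1` as matrices. [cite: Balaban1984PropagatorsI, p.30 after (1.76)] -/
theorem Phi176Inv_mul_Phi176 (ha : 0 ≤ a) : Phi176Inv n M a * Phi176 n M a = 1 :=
  ext_mulVec fun B => by rw [← Matrix.mulVec_mulVec, Phi176Inv_Phi176_mulVec n M a ha, Matrix.one_mulVec]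

/-- `φ⁻¹B = B − aφ⁻¹QΔ⁻¹Q*B` (i.e. `I − aφ⁻¹QΔ⁻¹Q* = φ⁻¹`, the step between the first two lines of (1.94)).
[cite: Balaban1984PropagatorsI, (1.94) p.33] -/
theorem Phi176Inv_eq_sub (ha : 0 ≤ a) (B : Tor M × Fin d → ℂ) :
    Phi176Inv n M a *ᵥ B = B - (a : ℂ) • (Phi176Inv n M a *ᵥ (PhiOp n M *ᵥ B)) := by
  have h := Phi176Inv_Phi176_mulVec n M a ha B
  rw [Phi176_mulVec, Matrix.mulVec_add, Matrix.mulVec_smul] at h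
  exact eq_sub_of_add_eq h

/-- `φ` fixes the constant configurations (`QΔ⁻¹Q*` annihilates them, `B5Phi162Torus.PhiOp_mulVec_const`; p.33
«acting on a constant configuration»). [cite: Balaban1984PropagatorsI, (1.76) p.30, p.33] -/
theorem Phi176_constV (c : Fin d → ℂ) : Phi176 n M a *ᵥ constV M c = constV M c := by
  have h0 : PhiOp n M *ᵥ constV M c = 0 :=
    PhiOp_mulVec_const n M (Nat.one_le_iff_ne_zero.mpr (NeZero.ne n)) c
  rw [Phi176_mulVec, h0, smul_zero, add_zero]

/-- `φ⁻¹` fixes the constant configurations. [cite: Balaban1984PropagatorsI, (1.76) p.30, p.33] -/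
theorem Phi176Inv_constV (ha : 0 ≤ a) (c : Fin d → ℂ) : Phi176Inv n M a *ᵥ constV M c = constV M c := by
  conv_lhs => rw [← Phi176_constV n M a c]
  exact Phi176Inv_Phi176_mulVec n M a ha _

/-- **`∂₁*φ⁻¹∂₁`** on unit-lattice scalars. [cite: Balaban1984PropagatorsI, (1.80) p.31, (1.94) p.33] -/
def GPhiE : Matrix (Tor M) (Tor M) ℂ := (GradOp M 1)ᴴ * Phi176Inv n M a * GradOp M 1

omit [NeZero n] in
/-- `(∂₁*φ⁻¹∂₁)t = ∂₁*(φ⁻¹(∂₁t))`. [cite: Balaban1984PropagatorsI, (1.80) p.31] -/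
theorem GPhiE_mulVec (t : Tor M → ℂ) :
    GPhiE n M a *ᵥ t = (GradOp M 1)ᴴ *ᵥ (Phi176Inv n M a *ᵥ (GradOp M 1 *ᵥ t)) := by
  rw [GPhiE, ← Matrix.mulVec_mulVec, ← Matrix.mulVec_mulVec]

/-- the symbol of `∂₁*φ⁻¹∂₁`: `g(p′) = Σ_μ |∂¹_μ(p′)|²/(1 + aφ_μ(p′))` (cf. (1.86): `Σ_λ|∂_{1,λ}|²/(Δ₀φ_λ)` up to
the factor `Δ₀`). [cite: Balaban1984PropagatorsI, (1.86) p.32] -/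
def gsymE (q : Tor M) : ℂ :=
  ∑ μ, conj (ssym M 1 μ q) * ssym M 1 μ q * ((((phi184 n M a μ q : ℝ)) : ℂ))⁻¹

omit [NeZero n] in
/-- `(∂₁*φ⁻¹∂₁t)~(p′) = g(p′)t̃(p′)` (the multiplier (1.86) up to the factor `Δ₀`). [cite: Balaban1984PropagatorsI, (1.86) p.32] -/
theorem dft_GPhiE (t : Tor M → ℂ) (q : Tor M) :
    (dft M *ᵥ (GPhiE n M a *ᵥ t)) q = gsymE n M a q * (dft M *ᵥ t) q := by
  rw [GPhiE, ← Matrix.mulVec_mulVec, ← Matrix.mulVec_mulVec, dft_GradOp_adjoint, gsymE, Finset.sum_mul]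
  refine Finset.sum_congr rfl fun μ _ => ?_
  rw [dft_Phi176Inv, dft_comp_GradOp]
  ring

omit [NeZero n] in
/-- `g(0) = 0` (the constants are in the kernel of `∂₁`; `∂₁*φ⁻¹∂₁` lives on the subspace «orthogonal to
constant functions»). [cite: Balaban1984PropagatorsI, p.30, (1.86) p.32] -/
theorem gsymE_zero : gsymE n M a 0 = 0 := by
  simp [gsymE, ssym_zero]

omit [NeZero n] in
/-- `g(p′)` is (the cast of) the non-negative real `Σ_μ |∂¹_μ(p′)|²·φ_μ(p′)⁻¹`. [cite: Balaban1984PropagatorsI, (1.86) p.32] -/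
theorem gsymE_eq_ofReal (q : Tor M) :
    gsymE n M a q = ((∑ μ, ‖ssym M 1 μ q‖ ^ 2 * (phi184 n M a μ q)⁻¹ : ℝ) : ℂ) := by
  rw [gsymE, Complex.ofReal_sum]
  refine Finset.sum_congr rfl fun μ _ => ?_
  rw [Complex.conj_mul' (ssym M 1 μ q)]
  push_cast
  ring

omit [NeZero n] in
/-- **`g(p′) ≠ 0` for `p′ ≠ 0`** (`a ≥ 0`): some `∂¹_μ(p′) ≠ 0` and every `φ_μ(p′) > 0` — the operator
`∂₁*φ⁻¹∂₁` «is positive» on `1^⊥` (p. 31: «∂₁*φ⁻¹∂₁ is positive also because φ⁻¹ is positive»).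
[cite: Balaban1984PropagatorsI, p.31 before (1.80)] -/
theorem gsymE_ne_zero (ha : 0 ≤ a) {q : Tor M} (hq : q ≠ 0) : gsymE n M a q ≠ 0 := by
  obtain ⟨μ₀, hμ₀⟩ : ∃ μ, ssym M 1 μ q ≠ 0 := by
    by_contra h
    push Not at h
    apply hq
    apply (lsym_eq_zero_iff M one_ne_zero q).mp
    simp only [lsym, h, mul_zero, Finset.sum_const_zero]
  have hpos : ∀ μ, 0 ≤ ‖ssym M 1 μ q‖ ^ 2 * (phi184 n M a μ q)⁻¹ := fun μ =>
    mul_nonneg (sq_nonneg _) (inv_nonneg.mpr (phi184_pos n M a ha μ q).le)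
  have hlt : 0 < ∑ μ, ‖ssym M 1 μ q‖ ^ 2 * (phi184 n M a μ q)⁻¹ :=
    lt_of_lt_of_le (mul_pos (by positivity) (inv_pos.mpr (phi184_pos n M a ha μ₀ q)))
      (Finset.single_le_sum (fun μ _ => hpos μ) (Finset.mem_univ μ₀))
  rw [gsymE_eq_ofReal]
  exact_mod_cast hlt.ne'

/-- **`(∂₁*φ⁻¹∂₁)⁻¹`** on the subspace orthogonal to constants: the scalar Fourier multiplier `g(p′)⁻¹`
(value `0` at `p′ = 0`). [cite: Balaban1984PropagatorsI, (1.80) p.31, (1.94) p.33] -/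
def GPhiEInv : Matrix (Tor M) (Tor M) ℂ := sMul M fun q => (gsymE n M a q)⁻¹

omit [NeZero n] in
/-- `(∂₁*φ⁻¹∂₁)(∂₁*φ⁻¹∂₁)⁻¹t = t` for `t ⊥ 1` (`a ≥ 0`). [cite: Balaban1984PropagatorsI, (1.80) p.31] -/
theorem GPhiE_GPhiEInv_of_orth (ha : 0 ≤ a) (t : Tor M → ℂ) (ht : ∑ y, t y = 0) :
    GPhiE n M a *ᵥ (GPhiEInv n M a *ᵥ t) = t := by
  refine dft_mulVec_injective M ?_
  funext q
  show (dft M *ᵥ (GPhiE n M a *ᵥ (GPhiEInv n M a *ᵥ t))) q = (dft M *ᵥ t) q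
  rw [dft_GPhiE, GPhiEInv, dft_sMul]
  by_cases hq : q = 0
  · subst hq
    rw [(sum_eq_zero_iff_dft_zero M t).mp ht, mul_zero, mul_zero]
  · rw [← mul_assoc, mul_inv_cancel₀ (gsymE_ne_zero n M a ha hq), one_mul]

omit [NeZero n] in
/-- `(∂₁*φ⁻¹∂₁)⁻¹(∂₁*φ⁻¹∂₁)t = t` for `t ⊥ 1` (`a ≥ 0`). [cite: Balaban1984PropagatorsI, (1.80) p.31] -/
theorem GPhiEInv_GPhiE_of_orth (ha : 0 ≤ a) (t : Tor M → ℂ) (ht : ∑ y, t y = 0) :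
    GPhiEInv n M a *ᵥ (GPhiE n M a *ᵥ t) = t := by
  refine dft_mulVec_injective M ?_
  funext q
  show (dft M *ᵥ (GPhiEInv n M a *ᵥ (GPhiE n M a *ᵥ t))) q = (dft M *ᵥ t) q
  rw [GPhiEInv, dft_sMul, dft_GPhiE]
  by_cases hq : q = 0
  · subst hq
    rw [(sum_eq_zero_iff_dft_zero M t).mp ht, mul_zero, mul_zero]
  · rw [← mul_assoc, inv_mul_cancel₀ (gsymE_ne_zero n M a ha hq), one_mul]

omit [NeZero n] in
/-- `(∂₁*φ⁻¹∂₁)⁻¹t ⊥ 1` for every `t` (the inverse is taken on the subspace «orthogonal to constant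
functions»). [cite: Balaban1984PropagatorsI, p.30, (1.80) p.31] -/
theorem sum_GPhiEInv (t : Tor M → ℂ) : ∑ y, (GPhiEInv n M a *ᵥ t) y = 0 := by
  rw [sum_eq_zero_iff_dft_zero, GPhiEInv, dft_sMul, gsymE_zero, inv_zero, zero_mul]

omit [NeZero n] in
/-- `(∂₁*φ⁻¹∂₁)t ⊥ 1` for every `t` (it is a `∂₁*`). [cite: Balaban1984PropagatorsI, (1.80) p.31] -/
theorem sum_GPhiE (t : Tor M → ℂ) : ∑ y, (GPhiE n M a *ᵥ t) y = 0 := by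
  rw [GPhiE_mulVec]
  exact sum_GradOp_adjoint M 1 _

/-! ## §2 Tools: `Δ⁻¹Δ` on vector fields, `Δ⁻¹∂ = ∂Δ⁻¹`, `Δ_a` and `G` on constants, «RΔ⁻¹Q′* = 0» -/

/-- `Δ⁻¹ΔV = V` for a vector field `V ⊥` constants (p. 22 «by Δ⁻¹ we denote its inverse on this
subspace»; companion of `B5Hk160Torus.Lap_LapVinv_of_orthConst`). [cite: Balaban1984PropagatorsI, Sect. C p.22] -/
theorem LapVinv_Lap_of_orthConst {V : Tor (fine n M) × Fin d → ℂ} (hV : OrthConst (fine n M) V) :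
    LapVinv n M *ᵥ (Lap n M *ᵥ V) = V := by
  have hnc : (n : ℂ) ≠ 0 := by exact_mod_cast NeZero.ne n
  refine eq_of_comp_eq (fine n M) fun κ => dft_mulVec_injective (fine n M) ?_
  funext p
  show (dft (fine n M) *ᵥ comp (fine n M) (LapVinv n M *ᵥ (Lap n M *ᵥ V)) κ) p
    = (dft (fine n M) *ᵥ comp (fine n M) V κ) p
  rw [comp_LapVinv_mulVec, dft_LapSinv_apply, dft_comp_Lap]
  by_cases hp : p = 0
  · subst hp
    rw [dft_comp_zero_of_orthConst (fine n M) hV κ, mul_zero, mul_zero]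
  · have hl : lsym (fine n M) (n : ℂ) p ≠ 0 := fun h => hp ((lsym_eq_zero_iff (fine n M) hnc p).mp h)
    rw [← mul_assoc, inv_mul_cancel₀ hl, one_mul]

/-- `Δ⁻¹∂ = ∂Δ⁻¹` (componentwise `Δ⁻¹` on the left, scalar `Δ⁻¹` on the right; both are Fourier
multipliers) — the step «Applying the operator QΔ⁻¹ to (1.73) and using (1.55)»: `QΔ⁻¹∂ = Q∂Δ⁻¹ = ∂₁Q′Δ⁻¹`.
[cite: Balaban1984PropagatorsI, (1.75) p.30] -/
theorem LapVinv_GradOp (s : Tor (fine n M) → ℂ) :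
    LapVinv n M *ᵥ (GradOp (fine n M) (n : ℂ) *ᵥ s)
      = GradOp (fine n M) (n : ℂ) *ᵥ (LapSinv (fine n M) (n : ℂ) *ᵥ s) := by
  refine eq_of_comp_eq (fine n M) fun κ => dft_mulVec_injective (fine n M) ?_
  funext p
  show (dft (fine n M) *ᵥ comp (fine n M) (LapVinv n M *ᵥ (GradOp (fine n M) (n : ℂ) *ᵥ s)) κ) p
    = (dft (fine n M) *ᵥ comp (fine n M)
        (GradOp (fine n M) (n : ℂ) *ᵥ (LapSinv (fine n M) (n : ℂ) *ᵥ s)) κ) p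
  rw [comp_LapVinv_mulVec, dft_LapSinv_apply, dft_comp_GradOp, dft_comp_GradOp, dft_LapSinv_apply]
  ring

/-- `ΔA ⊥` constants for every vector field `A` (componentwise; used in (1.74)). [cite: Balaban1984PropagatorsI, (1.21) p.21, (1.74) p.30] -/
theorem orthConst_Lap (A : Tor (fine n M) × Fin d → ℂ) : OrthConst (fine n M) (Lap n M *ᵥ A) :=
  orthConst_of_dft_comp_zero (fine n M) fun κ => by rw [dft_comp_Lap, lsym_zero, zero_mul]

/-- the left side of (1.73) expanded: `Δ_aA = ΔA − ∂(P(∂*A)) + aQ*(QA)`.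
[cite: Balaban1984PropagatorsI, (1.73) p.30] -/
theorem DeltaA_mulVec' (A : Tor (fine n M) × Fin d → ℂ) :
    DeltaA n M a *ᵥ A
      = Lap n M *ᵥ A
        - GradOp (fine n M) (n : ℂ) *ᵥ (PcT n M (n : ℂ) *ᵥ ((GradOp (fine n M) (n : ℂ))ᴴ *ᵥ A))
        + (a : ℂ) • (QvAdj n M *ᵥ (QvOp n M *ᵥ A)) := by
  rw [DeltaA, Matrix.add_mulVec, Matrix.sub_mulVec, Matrix.smul_mulVec, ← Matrix.mulVec_mulVec,
    ← Matrix.mulVec_mulVec, ← Matrix.mulVec_mulVec]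

/-- **(1.74) «a⟨1, Q*QA_μ⟩ = a⟨1, A_μ⟩ = ⟨1, J_μ⟩»**: if `J ⊥` constants and `Δ_aA = J`, then `A ⊥` constants
(`a ≠ 0`). [cite: Balaban1984PropagatorsI, (1.74) p.30] -/
theorem orthConst_of_DeltaA_eq (ha : a ≠ 0) {A J : Tor (fine n M) × Fin d → ℂ}
    (hJ : OrthConst (fine n M) J) (hA : DeltaA n M a *ᵥ A = J) : OrthConst (fine n M) A := by
  have hn : 1 ≤ n := Nat.one_le_iff_ne_zero.mpr (NeZero.ne n)
  have ha' : (a : ℂ) ≠ 0 := by exact_mod_cast ha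
  intro μ
  have h := congrArg (fun V : Tor (fine n M) × Fin d → ℂ => ∑ x, V (x, μ)) hA
  simp only [DeltaA_mulVec', Pi.add_apply, Pi.sub_apply, Pi.smul_apply, smul_eq_mul,
    Finset.sum_add_distrib, Finset.sum_sub_distrib, ← Finset.mul_sum] at h
  rw [orthConst_Lap n M A μ, (orthConst_GradOp (fine n M) (n : ℂ) _) μ,
    B5DeltaA169.sum_QvAdj_QvOp n M hn A μ, hJ μ, sub_zero, zero_add] at h
  exact (mul_eq_zero.mp h).resolve_left ha'

/-- `Δ_a` on a constant configuration: `Δ_aA₀ = aA₀` (`ΔA₀ = 0`, `∂*A₀ = 0`, `Q*QA₀ = A₀`).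
[cite: Balaban1984PropagatorsI, (1.74) p.30, (1.82) p.31] -/
theorem DeltaA_constV (c : Fin d → ℂ) :
    DeltaA n M a *ᵥ constV (fine n M) c = (a : ℂ) • constV (fine n M) c := by
  rw [DeltaA_mulVec', Lap_constV, divS_constV, Matrix.mulVec_zero, Matrix.mulVec_zero, sub_zero, zero_add,
    QvOp_constV, QvAdj_constV]

/-- **(1.82) «GJ = GJ′ + a⁻¹J₀»**, the constant part: `G A₀ = a⁻¹A₀` for a constant configuration `A₀`
(`a > 0`). [cite: Balaban1984PropagatorsI, (1.82) p.31] -/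
theorem G_constV (ha : 0 < a) (c : Fin d → ℂ) :
    (DeltaA n M a)⁻¹ *ᵥ constV (fine n M) c = (a : ℂ)⁻¹ • constV (fine n M) c := by
  have hn : 1 ≤ n := Nat.one_le_iff_ne_zero.mpr (NeZero.ne n)
  have ha' : (a : ℂ) ≠ 0 := by exact_mod_cast ha.ne'
  have hdet := (Matrix.isUnit_iff_isUnit_det _).mp (isUnit_DeltaA n hn M a ha)
  have h : (DeltaA n M a)⁻¹ *ᵥ (DeltaA n M a *ᵥ constV (fine n M) c) = constV (fine n M) c := by
    rw [Matrix.mulVec_mulVec, Matrix.nonsing_inv_mul _ hdet, Matrix.one_mulVec]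
  rw [DeltaA_constV, Matrix.mulVec_smul] at h
  calc (DeltaA n M a)⁻¹ *ᵥ constV (fine n M) c
      = (a : ℂ)⁻¹ • ((a : ℂ) • ((DeltaA n M a)⁻¹ *ᵥ constV (fine n M) c)) := by
        rw [smul_smul, inv_mul_cancel₀ ha', one_smul]
    _ = (a : ℂ)⁻¹ • constV (fine n M) c := by rw [h]

/-- «The operator ∂*GQ* acting on a constant configuration gives 0». [cite: Balaban1984PropagatorsI, p.33] -/
theorem divS_G_QvAdj_constV (ha : 0 < a) (c : Fin d → ℂ) :
    (GradOp (fine n M) (n : ℂ))ᴴ *ᵥ ((DeltaA n M a)⁻¹ *ᵥ (QvAdj n M *ᵥ constV M c)) = 0 := by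
  rw [QvAdj_constV, G_constV n M a ha, Matrix.mulVec_smul, divS_constV, smul_zero]

/-- `Q′*` of a constant is the same constant (the weights of (1.21) cancel: `Q′*1 = n^d·(Q′)ᴴ1 = 1`).
[cite: Balaban1984PropagatorsI, Sect. C p.22] -/
theorem QsAdj_const (c : ℂ) : QsAdj n M *ᵥ (fun _ : Tor M => c) = fun _ : Tor (fine n M) => c := by
  have hnd : ((n : ℂ) ^ d) ≠ 0 := pow_ne_zero _ (by exact_mod_cast NeZero.ne n)
  rw [QsAdj, Matrix.smul_mulVec, QsOp_adjoint_const]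
  funext x
  simp only [Pi.smul_apply, smul_eq_mul]
  field_simp

/-- **«so RΔ⁻¹Q′* = 0»**, the `P`-part: `PΔ⁻¹Q′*t = Δ⁻¹Q′*t` for EVERY unit-lattice scalar `t` (for `t ⊥ 1`
since `P = Δ⁻¹Q′*(Q′Δ⁻²Q′*)⁻¹Q′Δ⁻¹`; for constants both sides vanish). [cite: Balaban1984PropagatorsI, p.33 before (1.95)] -/
theorem PcT_LapSinv_QsAdj (t : Tor M → ℂ) :
    PcT n M (n : ℂ) *ᵥ (LapSinv (fine n M) (n : ℂ) *ᵥ (QsAdj n M *ᵥ t))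
      = LapSinv (fine n M) (n : ℂ) *ᵥ (QsAdj n M *ᵥ t) := by
  have hnc : (n : ℂ) ≠ 0 := by exact_mod_cast NeZero.ne n
  have hnd : ((n : ℂ) ^ d) ≠ 0 := pow_ne_zero _ hnc
  -- the part orthogonal to constants
  have horth : ∀ t' : Tor M → ℂ, ∑ y, t' y = 0 →
      PcT n M (n : ℂ) *ᵥ (LapSinv (fine n M) (n : ℂ) *ᵥ (QsAdj n M *ᵥ t'))
        = LapSinv (fine n M) (n : ℂ) *ᵥ (QsAdj n M *ᵥ t') := by
    intro t' ht'
    have hM : Minv n M (n : ℂ) *ᵥ (QsOp n M *ᵥ (LapSinv (fine n M) (n : ℂ) *ᵥ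
        (LapSinv (fine n M) (n : ℂ) *ᵥ (QsAdj n M *ᵥ t')))) = ((n : ℂ) ^ d) • t' := by
      rw [QsAdj, Matrix.smul_mulVec, Matrix.mulVec_smul, Matrix.mulVec_smul, Matrix.mulVec_smul,
        ← Mop_mulVec, Matrix.mulVec_smul, Minv_Mop_of_orth n M (n : ℂ) hnc t' ht']
    rw [PcT_mulVec, hM, Matrix.mulVec_smul, QsAdj, Matrix.smul_mulVec]
  -- the constant part
  have hconst : ∀ c : ℂ, LapSinv (fine n M) (n : ℂ) *ᵥ (QsAdj n M *ᵥ fun _ : Tor M => c) = 0 := by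
    intro c
    rw [QsAdj_const, LapSinv_const]
  -- decompose `t = t′ + c`, `t′ ⊥ 1`
  set c : ℂ := ((Fintype.card (Tor M) : ℂ))⁻¹ * ∑ y, t y with hc
  set t' : Tor M → ℂ := fun y => t y - c with ht'def
  have ht : t = t' + fun _ => c := by
    funext y
    simp only [ht'def, Pi.add_apply, sub_add_cancel]
  have ht' : ∑ y, t' y = 0 := by
    have hcard : ((Fintype.card (Tor M) : ℂ)) ≠ 0 := Nat.cast_ne_zero.mpr Fintype.card_ne_zero
    simp only [ht'def, Finset.sum_sub_distrib, Finset.sum_const, Finset.card_univ, nsmul_eq_mul, hc]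
    rw [← mul_assoc, mul_inv_cancel₀ hcard, one_mul, sub_self]
  rw [ht, Matrix.mulVec_add, Matrix.mulVec_add, Matrix.mulVec_add, hconst, horth _ ht', Matrix.mulVec_zero]

/-- **«so RΔ⁻¹Q′* = 0»** with `R = I − P`, as a matrix identity. [cite: Balaban1984PropagatorsI, p.33 before (1.95)] -/
theorem oneSubPcT_LapSinv_QsAdj :
    (1 - PcT n M (n : ℂ)) * LapSinv (fine n M) (n : ℂ) * QsAdj n M = 0 :=
  ext_mulVec fun t => by
    rw [← Matrix.mulVec_mulVec, ← Matrix.mulVec_mulVec, Matrix.sub_mulVec, Matrix.one_mulVec,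
      PcT_LapSinv_QsAdj, sub_self, Matrix.zero_mulVec]

end

end Literature.MathematicalPhysics.QuantumFieldTheory.Balaban1983to89.B5Phi176Torus
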